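import Literature.NumberTheory.EllipticCurves.UnramifiedLayerResidueProofs
import Literature.NumberTheory.EllipticCurves.ReductionInertiaInvarianceProofs
import Literature.NumberTheory.EllipticCurves.HasseWeilGoodReductionFrobeniusProofs
import Literature.NumberTheory.EllipticCurves.Sha
import Literature.NumberTheory.EllipticCurves.GeomPointReduction
import HarnessLib

/-!
# Reductions of Galois conjugates: the Teichmüller layer and the Frobenius congruence

`Proofs` file (theorems only) in topic `NumberTheory/EllipticCurves`; part of the local input
(brick B) of the elementary proof of Greenberg's Lemma 3.4 at the layer `n = 0` (LNM 1716, p. 89).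
For a Weierstrass equation `M` over the valuation ring `𝒪_w` of `K̄_v` with `M ⊗ K̄_v = E ⊗ K̄_v`
and the reduction map `P ↦ P̃` of `M` (`WeierstrassCurve.reducePoint`):

* `reducePoint_congrEquiv_smul_eq_of_val` — if `σ ∈ Γ_{K_v}` moves the integral coordinates of
  `P` by elements of `𝔪_w`, then `(σP)~ = P̃` (tree: `reducePoint_some_eq_of_val`);
* `exists_layer_forall_val_smul_sub_lt_one` — **the Teichmüller layer**: for finitely many
  `w`-integers `x` there is `n ≥ 1` such that every `σ` fixing a primitive `(qⁿ - 1)`-th root of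
  unity `ζ_L` satisfies `w(σx - x) < 1` for all of them (each residue `x̄ ∈ k̄_v` lies in some
  `𝔽_{q^d}`, and `x ≡ 0` or `x ≡ ζ_L^i (mod 𝔪_w)` by `exists_residue_eq_of_pow_eq`; Serre, *Local
  Fields*, II §4 Prop. 8);
* `residueMap_pow_eq_of_reducePoint_smul_eq` — **the Frobenius congruence**: for an arithmetic
  Frobenius `τ` (`τz ≡ z^q`), `(τP)~ = P̃` forces the residues of the integral coordinates of `P`
  to satisfy `x̄^q = x̄` (so these reductions form a finite set,
  `finite_setOf_reducePoint_frobenius`).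

## References

* [SerreLocalFields1979] J.-P. Serre, *Local Fields*, II §4 Prop. 8, IV §4 Prop. 16.
* [SilvermanAEC2009] J. H. Silverman, *AEC*, VII.§2, VIII.§1.
* [GreenbergLNM1716] R. Greenberg, LNM 1716 (1999), §2 (p. 70: `Ẽ(f)_p` finite for the residue
  field `f` of `K_v`), §3 Lemma 3.4.
-/

noncomputable section

open scoped Classical NNReal
open NumberField IsDedekindDomain Polynomial

universe u

namespace IsDedekindDomain.HeightOneSpectrum

open Literature.NumberTheory.EllipticCurves Literature.NumberTheory.GaloisRepresentations Field
  _root_.WeierstrassCurve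

variable {K : Type u} [Field K] [NumberField K] {v : HeightOneSpectrum (𝓞 K)}
  {w : Valuation (AlgebraicClosure (v.adicCompletion K)) ℝ≥0}
  (hw : ∀ x, (w x : ℝ) = spectralNorm (v.adicCompletion K) (AlgebraicClosure (v.adicCompletion K)) x)

/-! ## §1 Same reduction for a conjugate moving the coordinates within `𝔪_w` -/

include hw in
/-- **`(σP)~ = P̃` when `σ` moves the integral coordinates of `P` by elements of `𝔪_w`.** For a
Weierstrass equation `M` over `𝒪_w` with `M ⊗ K̄_v = E ⊗ K̄_v` (transport
`Affine.Point.congrEquiv`, the identity on coordinates), `σ ∈ Γ_{K_v}` (a `w`-isometry) and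
`P ∈ E(K̄_v)` whose `w`-integral coordinates `x` satisfy `w(σx - x) < 1`, the points `σP` and `P`
have the same reduction. Silverman, *AEC*, VII.§2, VIII.§1 (tree `reducePoint_some_eq_of_val`).
[cite: SilvermanAEC2009, VII.§2] -/
theorem reducePoint_congrEquiv_smul_eq_of_val {W : WeierstrassCurve K}
    {M : WeierstrassCurve ↥w.valuationSubring}
    (hMK : M.baseChange (AlgebraicClosure (v.adicCompletion K)) =
      W.baseChange (AlgebraicClosure (v.adicCompletion K)))
    (σ : absoluteGaloisGroup (v.adicCompletion K)) (P : localPoints W (v.adicCompletion K))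
    (hP : ∀ x y h, P = Affine.Point.some x y h →
      (w x ≤ 1 → w (σ • x - x) < 1) ∧ (w y ≤ 1 → w (σ • y - y) < 1)) :
    M.reducePoint (Affine.Point.congrEquiv hMK.symm (σ • P)) =
      M.reducePoint (Affine.Point.congrEquiv hMK.symm P) := by
  rcases P with _ | ⟨x, y, h⟩
  · have h0 : σ • (0 : localPoints W (v.adicCompletion K)) = 0 := smul_zero σ
    exact congrArg (fun Q ↦ M.reducePoint (Affine.Point.congrEquiv hMK.symm Q)) h0
  · obtain ⟨hx, hy⟩ := hP x y h rfl
    rw [localPoints.smul_def, Affine.Point.map_some]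
    refine (congrArg M.reducePoint (Affine.Point.congrEquiv_some hMK.symm _)).trans ?_
    refine Eq.trans ?_ (congrArg M.reducePoint (Affine.Point.congrEquiv_some hMK.symm h)).symm
    exact reducePoint_some_eq_of_val (W₀ := M) (spectralValuation_smul hw σ x) hx hy

/-! ## §2 The Teichmüller layer -/

/-- Every element of `k̄ = \overline{𝔽_q}` lies in a finite field: `a^{q^d} = a` for some `d ≥ 1`
(`d = [𝔽_q(a) : 𝔽_q]`). [folklore] -/
theorem exists_pow_residueCard_pow_eq_self {k : Type*} [Field k] [Finite k] (a : AlgebraicClosure k) :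
    ∃ d : ℕ, 0 < d ∧ a ^ (Nat.card k ^ d) = a := by
  set F := IntermediateField.adjoin k ({a} : Set (AlgebraicClosure k)) with hF
  have hint : IsIntegral k a := Algebra.IsIntegral.isIntegral a
  haveI : FiniteDimensional k F := IntermediateField.adjoin.finiteDimensional hint
  haveI : Finite F := Module.finite_of_finite k
  haveI : Fintype F := Fintype.ofFinite F
  refine ⟨Module.finrank k F, Module.finrank_pos, ?_⟩
  have hcard : Nat.card F = Nat.card k ^ Module.finrank k F := Module.natCard_eq_pow_finrank
  have ha : (⟨a, IntermediateField.mem_adjoin_simple_self k a⟩ : F) ^ Fintype.card F =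
      ⟨a, IntermediateField.mem_adjoin_simple_self k a⟩ := FiniteField.pow_card _
  rw [Fintype.card_eq_nat_card, hcard] at ha
  exact congrArg Subtype.val ha

/-- `a^{q^d} = a` and `d ∣ n` give `a^{q^n} = a`. [folklore] -/
theorem pow_pow_eq_self_of_dvd {R : Type*} [Monoid R] {a : R} {q d n : ℕ} (ha : a ^ q ^ d = a)
    (hdn : d ∣ n) : a ^ q ^ n = a := by
  obtain ⟨m, rfl⟩ := hdn
  induction m with
  | zero => rw [mul_zero, pow_zero, pow_one]
  | succ m ih => rw [Nat.mul_succ, pow_add, pow_mul, ih, ha]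

include hw in
/-- **The Teichmüller layer.** For finitely many `w`-integers `x ∈ K̄_v` there is `n ≥ 1` such
that every `σ ∈ Γ_{K_v}` fixing a primitive `(qⁿ - 1)`-th root of unity `ζ_L` moves each of them
within `𝔪_w`: `w(σx - x) < 1`. (Each residue lies in some `𝔽_{q^d} ⊆ k̄_v`; with `n` a common
multiple, `x ≡ t (mod 𝔪_w)` for some `t ∈ K_v(ζ_L)` by `exists_residue_eq_of_pow_eq`, and `σ`
fixes `t`.) Serre, *Local Fields*, II §4 Prop. 8; Greenberg, LNM 1716, §2 p. 70.
[cite: SerreLocalFields1979, Ch. II §4 Prop. 8] -/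
theorem exists_layer_forall_val_smul_sub_lt_one {𝔐 : Ideal (localAbsIntegers v)}
    (h𝔐 : 𝔐 ∈ v.localPrimesAbove) (X : Finset (AlgebraicClosure (v.adicCompletion K)))
    (hX : ∀ x ∈ X, w x ≤ 1) :
    ∃ n : ℕ, n ≠ 0 ∧ ∀ ζL : AlgebraicClosure (v.adicCompletion K),
      IsPrimitiveRoot ζL (Nat.card (IsLocalRing.ResidueField (v.adicCompletionIntegers K)) ^ n - 1) →
      ∀ σ : absoluteGaloisGroup (v.adicCompletion K), σ • ζL = ζL →
        ∀ x ∈ X, w (σ • x - x) < 1 := by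
  obtain ⟨r, hr, -, -⟩ := exists_residueMap (v := v) hw h𝔐
  haveI : Finite (IsLocalRing.ResidueField (v.adicCompletionIntegers K)) :=
    finite_residueField_adicCompletionIntegers K v
  set q := Nat.card (IsLocalRing.ResidueField (v.adicCompletionIntegers K)) with hq
  -- a common `n`: the product of the degrees `d_x`
  have hdeg : ∀ x : X, ∃ d : ℕ, 0 < d ∧ r ⟨x, hX x x.2⟩ ^ q ^ d = r ⟨x, hX x x.2⟩ := fun x ↦
    exists_pow_residueCard_pow_eq_self _
  choose d hd0 hd using hdeg
  refine ⟨∏ x : X, d x, ?_, fun ζL hζL σ hσ x hx ↦ ?_⟩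
  · rw [Finset.prod_ne_zero_iff]
    exact fun x _ ↦ (hd0 x).ne'
  · have hn : (∏ x : X, d x) ≠ 0 := by
      rw [Finset.prod_ne_zero_iff]; exact fun x _ ↦ (hd0 x).ne'
    have hxn : r ⟨x, hX x hx⟩ ^ q ^ (∏ y : X, d y) = r ⟨x, hX x hx⟩ :=
      pow_pow_eq_self_of_dvd (hd ⟨x, hx⟩) (Finset.dvd_prod_of_mem _ (Finset.mem_univ _))
    obtain ⟨t, htL, ht1, hrt⟩ := exists_residue_eq_of_pow_eq hw hr hn hζL hxn
    -- `x ≡ t (mod 𝔪_w)` and `σ t = t`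
    have hxt : w (x - t) < 1 := by
      have h0 : r (⟨x, hX x hx⟩ - ⟨t, ht1⟩) = 0 := by rw [map_sub, hrt, sub_self]
      exact (hr _).mp h0
    have hm0 : q ^ (∏ y : X, d y) - 1 ≠ 0 := residueCard_pow_sub_one_ne_zero (v := v) hn
    have hσt : σ • t = t := (forall_smul_eq_self_iff_smul_eq hm0 hζL.pow_eq_one σ).mpr hσ t htL
    have e : σ • x - x = σ • (x - t) - (x - t) := by rw [smul_sub, hσt]; ring
    rw [e]
    refine lt_of_le_of_lt (Valuation.map_sub w _ _) (max_lt ?_ hxt)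
    rwa [spectralValuation_smul hw]

/-! ## §3 The Frobenius congruence -/

include hw in
/-- **The Frobenius congruence on reductions.** Let `τ ∈ Γ_{K_v}` be an arithmetic Frobenius at
`𝔐` (`τz ≡ z^q (mod 𝔐)` on `\bar 𝓞_v = 𝒪_w`) and `r : 𝒪_w → k̄_v` the residue map of
`exists_residueMap`. If an integral point `P = (x, y)` of a Weierstrass equation `M` over `𝒪_w`
with unit discriminant has the same reduction as `τP`, then `x̄^q = x̄` and `ȳ^q = ȳ` in `k̄_v`
(`x̄ = r x`). Greenberg, LNM 1716, §2 p. 70 (the finite group `Ẽ(f)`); Silverman, *AEC*, VII.§2.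
[cite: GreenbergLNM1716, §2 p. 70] -/
theorem residueMap_pow_eq_of_reducePoint_smul_eq {𝔐 : Ideal (localAbsIntegers v)}
    {r : w.integer →+* AlgebraicClosure (IsLocalRing.ResidueField (v.adicCompletionIntegers K))}
    (hr : ∀ a : w.integer, r a = 0 ↔ w (a : AlgebraicClosure (v.adicCompletion K)) < 1)
    (hrF : ∀ {σ : absoluteGaloisGroup (v.adicCompletion K)},
      IsArithFrobAt (v.adicCompletionIntegers K) σ 𝔐 →
        ∀ (z : w.integer) (h : w (σ • (z : AlgebraicClosure (v.adicCompletion K))) ≤ 1),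
          r ⟨σ • (z : AlgebraicClosure (v.adicCompletion K)), h⟩ =
            r z ^ Nat.card (IsLocalRing.ResidueField (v.adicCompletionIntegers K)))
    {τ : absoluteGaloisGroup (v.adicCompletion K)} (hτ : IsArithFrobAt (v.adicCompletionIntegers K) τ 𝔐)
    {W : WeierstrassCurve K} {M : WeierstrassCurve ↥w.valuationSubring} (hΔu : IsUnit M.Δ)
    (hMK : M.baseChange (AlgebraicClosure (v.adicCompletion K)) =
      W.baseChange (AlgebraicClosure (v.adicCompletion K)))
    {x y : AlgebraicClosure (v.adicCompletion K)}
    {h : (W.baseChange (AlgebraicClosure (v.adicCompletion K))).toAffine.Nonsingular x y}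
    (hx : w x ≤ 1) {P : localPoints W (v.adicCompletion K)} (hPxy : P = Affine.Point.some x y h)
    (heq : M.reducePoint (Affine.Point.congrEquiv hMK.symm (τ • P)) =
      M.reducePoint (Affine.Point.congrEquiv hMK.symm P)) :
    ∃ hy : w y ≤ 1, r ⟨x, hx⟩ ^ Nat.card (IsLocalRing.ResidueField (v.adicCompletionIntegers K)) = r ⟨x, hx⟩ ∧
      r ⟨y, hy⟩ ^ Nat.card (IsLocalRing.ResidueField (v.adicCompletionIntegers K)) = r ⟨y, hy⟩ := by
  subst hPxy
  have hvO : w.Integers w.valuationSubring := Valuation.valuationSubring.integers w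
  haveI hM : M.IsElliptic := ⟨hΔu⟩
  haveI := isElliptic_map_residue (W := M) hΔu
  have hMns : (M.baseChange (AlgebraicClosure (v.adicCompletion K))).toAffine.Nonsingular x y := by
    rw [hMK]; exact h
  have hy : w y ≤ 1 := v_Y_le_one_of_v_X_le_one hvO hMns.1 hx
  have hτx : w (τ • x) ≤ 1 := by rwa [spectralValuation_smul hw]
  have hτy : w (τ • y) ≤ 1 := by rwa [spectralValuation_smul hw]
  -- integral points as `O`-points, and their (nonsingular) reductions
  have hred : ∀ (a b : w.valuationSubring) (hab : (M.baseChange (AlgebraicClosure (v.adicCompletion K))).toAffine.Nonsingular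
      (algebraMap w.valuationSubring _ a) (algebraMap w.valuationSubring _ b)),
      ∃ hns, M.reducePoint (.some _ _ hab) =
        .some (IsLocalRing.residue w.valuationSubring a) (IsLocalRing.residue w.valuationSubring b) hns := by
    intro a b hab
    have heqO : M.toAffine.Equation a b := (map_equation_iff hvO.hom_inj).mp hab.1
    have hns : (M.map (IsLocalRing.residue w.valuationSubring)).toAffine.Nonsingular
        (IsLocalRing.residue w.valuationSubring a) (IsLocalRing.residue w.valuationSubring b) :=
      (Affine.equation_iff_nonsingular).mp (heqO.map (IsLocalRing.residue w.valuationSubring))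
    exact ⟨hns, reducePoint_some_algebraMap hvO.hom_inj hab hns⟩
  -- reductions of integral points of `E(K̄_v)` through the transport
  have hmini : ∀ (x' y' : AlgebraicClosure (v.adicCompletion K))
      (h' : (W.baseChange (AlgebraicClosure (v.adicCompletion K))).toAffine.Nonsingular x' y')
      (hx' : w x' ≤ 1), ∃ (hy' : w y' ≤ 1) (hns : _),
        M.reducePoint (Affine.Point.congrEquiv hMK.symm (Affine.Point.some x' y' h')) =
          .some (IsLocalRing.residue w.valuationSubring ⟨x', hx'⟩) (IsLocalRing.residue w.valuationSubring ⟨y', hy'⟩) hns := by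
    intro x' y' h' hx'
    have hMns' : (M.baseChange (AlgebraicClosure (v.adicCompletion K))).toAffine.Nonsingular x' y' := by
      rw [hMK]; exact h'
    have hy' : w y' ≤ 1 := v_Y_le_one_of_v_X_le_one hvO hMns'.1 hx'
    obtain ⟨hns, e⟩ := hred ⟨x', hx'⟩ ⟨y', hy'⟩ hMns'
    exact ⟨hy', hns, (congrArg M.reducePoint (Affine.Point.congrEquiv_some hMK.symm h')).trans e⟩
  -- `τ • (x, y) = (τx, τy)`
  obtain ⟨h₂, hτP⟩ : ∃ h₂, τ • (show localPoints W (v.adicCompletion K) from Affine.Point.some x y h) =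
      Affine.Point.some (τ • x) (τ • y) h₂ :=
    ⟨_, by rw [localPoints.smul_def, Affine.Point.map_some]; rfl⟩
  rw [hτP] at heq
  obtain ⟨hy₁, hns₁, e₁⟩ := hmini (τ • x) (τ • y) h₂ hτx
  obtain ⟨hy₂, hns₂, e₂⟩ := hmini x y h hx
  rw [e₁, e₂] at heq
  simp only [Affine.Point.some.injEq] at heq
  obtain ⟨ex, ey⟩ := heq
  -- residues agree `⇒` `w(τz - z) < 1` `⇒` `r(τz) = r z`, and `r(τz) = (r z)^q`
  have key : ∀ (z : AlgebraicClosure (v.adicCompletion K)) (hz : w z ≤ 1) (hτz : w (τ • z) ≤ 1),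
      IsLocalRing.residue w.valuationSubring ⟨τ • z, hτz⟩ = IsLocalRing.residue w.valuationSubring ⟨z, hz⟩ →
        r ⟨z, hz⟩ ^ Nat.card (IsLocalRing.ResidueField (v.adicCompletionIntegers K)) = r ⟨z, hz⟩ := by
    intro z hz hτz hres
    have hmem : (⟨τ • z, hτz⟩ - ⟨z, hz⟩ : w.valuationSubring) ∈ IsLocalRing.maximalIdeal w.valuationSubring := Ideal.Quotient.eq.mp hres
    rw [IsLocalRing.mem_maximalIdeal, mem_nonunits_iff, hvO.isUnit_iff_valuation_eq_one] at hmem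
    have hlt : w (((⟨τ • z, hτz⟩ - ⟨z, hz⟩ : w.valuationSubring) : AlgebraicClosure (v.adicCompletion K))) < 1 :=
      lt_of_le_of_ne ((Valuation.mem_valuationSubring_iff w _).mp
        (⟨τ • z, hτz⟩ - ⟨z, hz⟩ : w.valuationSubring).2) hmem
    have h0 : r (⟨τ • z, hτz⟩ - ⟨z, hz⟩) = 0 := (hr _).mpr hlt
    rw [map_sub, sub_eq_zero, hrF hτ ⟨z, hz⟩ hτz] at h0
    exact h0
  exact ⟨hy₂, key x hx hτx ex, key y hy₂ (by rwa [spectralValuation_smul hw]) ey⟩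

/-- The reduction of an integral point `(x, y) ∈ E(K̄_v)` through the transport `E ⊗ K̄_v = M ⊗ K̄_v`
is the affine point `(x̄, ȳ)` of `M mod 𝔪_w` (nonsingular, `M` having unit discriminant).
[folklore] -/
theorem reducePoint_congrEquiv_some_of_val_le_one {W : WeierstrassCurve K}
    {M : WeierstrassCurve ↥w.valuationSubring} (hΔu : IsUnit M.Δ)
    (hMK : M.baseChange (AlgebraicClosure (v.adicCompletion K)) =
      W.baseChange (AlgebraicClosure (v.adicCompletion K)))
    (x y : AlgebraicClosure (v.adicCompletion K))
    (h : (W.baseChange (AlgebraicClosure (v.adicCompletion K))).toAffine.Nonsingular x y)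
    (hx : w x ≤ 1) :
    ∃ (hy : w y ≤ 1) (hns : _),
      M.reducePoint (Affine.Point.congrEquiv hMK.symm (Affine.Point.some x y h)) =
        .some (IsLocalRing.residue w.valuationSubring ⟨x, hx⟩)
          (IsLocalRing.residue w.valuationSubring ⟨y, hy⟩) hns := by
  have hvO : w.Integers w.valuationSubring := Valuation.valuationSubring.integers w
  haveI hM : M.IsElliptic := ⟨hΔu⟩
  haveI := isElliptic_map_residue (W := M) hΔu
  have hMns : (M.baseChange (AlgebraicClosure (v.adicCompletion K))).toAffine.Nonsingular x y := by
    rw [hMK]; exact h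
  have hy : w y ≤ 1 := v_Y_le_one_of_v_X_le_one hvO hMns.1 hx
  have hab : (M.baseChange (AlgebraicClosure (v.adicCompletion K))).toAffine.Nonsingular
      (algebraMap w.valuationSubring _ (⟨x, hx⟩ : w.valuationSubring))
      (algebraMap w.valuationSubring _ (⟨y, hy⟩ : w.valuationSubring)) := hMns
  have heqO : M.toAffine.Equation ⟨x, hx⟩ ⟨y, hy⟩ := (map_equation_iff hvO.hom_inj).mp hab.1
  have hns : (M.map (IsLocalRing.residue w.valuationSubring)).toAffine.Nonsingular
      (IsLocalRing.residue w.valuationSubring ⟨x, hx⟩) (IsLocalRing.residue w.valuationSubring ⟨y, hy⟩) :=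
    (Affine.equation_iff_nonsingular).mp (heqO.map (IsLocalRing.residue w.valuationSubring))
  exact ⟨hy, hns, (congrArg M.reducePoint (Affine.Point.congrEquiv_some hMK.symm h)).trans
    (reducePoint_some_algebraMap hvO.hom_inj hab hns)⟩

include hw in
/-- **The reductions fixed by Frobenius form a finite set** (`Ẽ(f)` is finite, Greenberg LNM 1716
§2 p. 70): for an arithmetic Frobenius `τ` at `𝔐`, the reductions `P̃` of the points `P ∈ E(K̄_v)`
with `(τP)~ = P̃` lie in the finite set of points of `M mod 𝔪_w` whose coordinates satisfy
`x̄^q = x̄` in `k̄_v`. [cite: GreenbergLNM1716, §2 p. 70] -/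
theorem finite_setOf_reducePoint_smul_frobenius_eq {𝔐 : Ideal (localAbsIntegers v)}
    (h𝔐 : 𝔐 ∈ v.localPrimesAbove) {τ : absoluteGaloisGroup (v.adicCompletion K)}
    (hτ : IsArithFrobAt (v.adicCompletionIntegers K) τ 𝔐)
    {W : WeierstrassCurve K} {M : WeierstrassCurve ↥w.valuationSubring} (hΔu : IsUnit M.Δ)
    (hMK : M.baseChange (AlgebraicClosure (v.adicCompletion K)) =
      W.baseChange (AlgebraicClosure (v.adicCompletion K))) :
    Set.Finite {Q : (M.map (IsLocalRing.residue w.valuationSubring)).toAffine.Point |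
      ∃ P : localPoints W (v.adicCompletion K),
        M.reducePoint (Affine.Point.congrEquiv hMK.symm P) = Q ∧
        M.reducePoint (Affine.Point.congrEquiv hMK.symm (τ • P)) = Q} := by
  obtain ⟨r, hr, -, hrF⟩ := exists_residueMap (v := v) hw h𝔐
  have hvO : w.Integers w.valuationSubring := Valuation.valuationSubring.integers w
  haveI : Finite (IsLocalRing.ResidueField (v.adicCompletionIntegers K)) :=
    finite_residueField_adicCompletionIntegers K v
  set q := Nat.card (IsLocalRing.ResidueField (v.adicCompletionIntegers K)) with hq
  set kbar := AlgebraicClosure (IsLocalRing.ResidueField (v.adicCompletionIntegers K))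
  -- `r` factors through the residue field of `𝒪_w`
  have hker : ∀ a ∈ IsLocalRing.maximalIdeal w.valuationSubring, r a = 0 := by
    intro a ha
    rw [IsLocalRing.mem_maximalIdeal, mem_nonunits_iff, hvO.isUnit_iff_valuation_eq_one] at ha
    exact (hr a).mpr (lt_of_le_of_ne ((Valuation.mem_valuationSubring_iff w _).mp a.2) ha)
  let rt : IsLocalRing.ResidueField w.valuationSubring →+* kbar :=
    Ideal.Quotient.lift (IsLocalRing.maximalIdeal w.valuationSubring) r hker
  have hrt : ∀ a, rt (IsLocalRing.residue w.valuationSubring a) = r a := fun a ↦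
    Ideal.Quotient.lift_mk _ _ _
  have hrt_inj : Function.Injective rt := RingHom.injective _
  -- the finite target: roots of `X^q - X`
  have hq1 : 1 < q := by rw [hq]; exact Finite.one_lt_card
  have hRfin : Set.Finite {a : kbar | a ^ q = a} := by
    have hne : (X ^ q - X : kbar[X]) ≠ 0 := by
      apply FiniteField.X_pow_card_sub_X_ne_zero kbar hq1
    refine ((X ^ q - X : kbar[X]).rootSet_finite kbar).subset fun a ha ↦ ?_
    rw [Polynomial.mem_rootSet_of_ne hne]
    simp only [map_sub, map_pow, aeval_X]
    rw [Set.mem_setOf_eq] at ha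
    rw [ha, sub_self]
  -- coordinates map
  let f : (M.map (IsLocalRing.residue w.valuationSubring)).toAffine.Point → Option (kbar × kbar) :=
    fun Q ↦ match Q with
      | .zero => none
      | .some a b _ => some (rt a, rt b)
  have hf : Function.Injective f := by
    rintro (_ | ⟨x₁, y₁, h₁⟩) (_ | ⟨x₂, y₂, h₂⟩) hQ
    · rfl
    · exact absurd hQ (by simp [f])
    · exact absurd hQ (by simp [f])
    · simp only [f, Option.some.injEq, Prod.mk.injEq] at hQ
      obtain ⟨e1, e2⟩ := hQ
      cases hrt_inj e1; cases hrt_inj e2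
      rfl
  set F : Set (Option (kbar × kbar)) :=
    insert none ((fun ab : kbar × kbar ↦ some ab) '' ({a : kbar | a ^ q = a} ×ˢ {a : kbar | a ^ q = a}))
    with hFdef
  have hFfin : F.Finite := (((hRfin.prod hRfin).image _).insert none)
  refine (hFfin.preimage (hf.injOn)).subset ?_
  rintro Q ⟨P, hPQ, hτPQ⟩
  rw [Set.mem_preimage]
  rcases P with _ | ⟨x, y, h⟩
  · -- `P = O`
    have : Q = 0 := by
      rw [← hPQ]
      exact (congrArg M.reducePoint (Affine.Point.congrEquiv_zero hMK.symm)).trans reducePoint_zero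
    subst this
    exact Set.mem_insert _ _
  · by_cases hx : w x ≤ 1
    · obtain ⟨hy, hxq, hyq⟩ := residueMap_pow_eq_of_reducePoint_smul_eq hw hr hrF hτ hΔu hMK hx rfl
        (hτPQ.trans hPQ.symm)
      obtain ⟨hy', hns, e⟩ := reducePoint_congrEquiv_some_of_val_le_one hΔu hMK x y h hx
      rw [← hPQ, e]
      refine Set.mem_insert_of_mem _ ⟨(r ⟨x, hx⟩, r ⟨y, hy'⟩), ⟨hxq, ?_⟩, ?_⟩
      · exact hyq
      · simp only [f, hrt]
        rfl
    · -- non-integral abscissa: reduces to `O`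
      have hQ0 : Q = 0 := by
        rw [← hPQ]
        refine (congrArg M.reducePoint (Affine.Point.congrEquiv_some hMK.symm h)).trans ?_
        exact reducePoint_some_of_not_mem _ ((not_mem_range_iff hvO).mpr (not_le.mp hx))
      subst hQ0
      exact Set.mem_insert _ _

end IsDedekindDomain.HeightOneSpectrum
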